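import Literature.LinearAlgebra.Subspace.MoebiusCount
import Literature.Combinatorics.Enumerative.QPfaffSaalschutz
import Mathlib.Algebra.Field.ZMod
import Mathlib.GroupTheory.Perm.Basic
import Mathlib.Data.Fintype.Perm
import Mathlib.Data.Nat.Factorial.BigOperators
import HarnessLib

/-!
# The number of subspaces of a finite vector space is the Gaussian binomial coefficient, the number of complete flags is the `q`-factorial; at `q = 1` they are the binomial coefficient and `n! = #S_n` (Cohn 2004, "projective geometry over `𝔽₁`"; Tits' "`(G/B)(𝔽₁) = W`")

Topic `LinearAlgebra/Subspace`; everything here is PROVED (Mathlib + the tree), there is no named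
fact and no new definition: the Gaussian binomial is the tree's
`Literature.Combinatorics.Enumerative.qBinomial q L k = [L choose k]_q` (defined by the `q`-Pascal rule
[Andrews1976Partitions, §3.3 (3.3.4)]), and the subspace counts are the subtypes of `Submodule k W`
already used in `MoebiusCount.lean` / `GaussianBinomialProduct.lean`, which prove the RECURSION
`A(C, j) = A(C + ke, j) + q^{codim C − j} A(C + ke, j − 1)` (`card_ge_codim_eq_add`) but, as their
docstrings say, deliberately no closed count.  This file supplies the closed count.

## Statements

Let `W` be a finite-dimensional vector space over a finite field `k` with `q = Nat.card k` elements.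

* `card_ge_codim_eq_qBinomial`: for a subspace `C ≤ W` of codimension `m` and every `j`,
  `#{Y : C ≤ Y ≤ W, codim Y = j} = [m choose j]_q`.
* `card_codim_eq_qBinomial` (`C = ⊥`): `#{Y ≤ W : codim Y = j} = [dim W choose j]_q`;
  `card_finrank_eq_qBinomial`: `#{Y ≤ W : dim Y = d} = [dim W choose d]_q` — **Cohn's Theorem 1**
  [Cohn2004, Thm. 1]: "If `q` is a prime power, then `[n choose k]_q` is the number of `k`-dimensional
  subspaces of `𝔽_qⁿ`" (here for every finite field and every finite-dimensional `W`; coordinate form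
  `card_subspaces_fin_eq_qBinomial` for `W = kⁿ`).
* `qBinomial_one`: `[L choose k]_1 = (L choose k)` — "Setting `q = 1` yields the ordinary binomial
  coefficients and recurrence (i.e., Pascal's triangle)" [Cohn2004, §2, after (2)]; with
  `qBinomial_one_eq_card_powersetCard`: `[n choose d]_1 = #{d-subsets of an n-set}`, the count of
  "`d`-dimensional subspaces of `𝔽₁ⁿ`" in Cohn's solution of his Puzzle 1 (`𝔽₁ⁿ` = an `n`-element set,
  subspaces = subsets) [Cohn2004, §§3–4] — the `q → 1` limit of Tits' "field of characteristic one".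
* `qBinomial_symm` (`[L choose k]_q = [L choose L−k]_q`), `qBinomial_succ_succ_of_le` (Cohn's
  recurrence (2): `[n,k]_q = [n−1,k]_q + q^{n−k}[n−1,k−1]_q`) and the closed form
  `qBinomial_mul_prod_eq_prod`: `[N choose k]_q · ∏_{i<k} (1 − q^{i+1}) = ∏_{i<k} (1 − q^{N−i})`, i.e.
  `[N,k]_q = (q^N−1)⋯(q^{N−k+1}−1) / ((q^k−1)⋯(q−1))` [Cohn2004, (3) and the first display of the proof
  of Thm. 1], stated division-free in an arbitrary commutative ring.
* Numerical anchors (`example`s, kernel-evaluated): `[4 choose 2]_2 = 35`, `[5 choose 2]_2 = 155`,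
  `[4 choose 2]_1 = 6`, `[5 choose 2]_1 = 10` — the point counts `#Gr(2,4)(𝔽₂)`, `#Gr(2,5)(𝔽₂)` and the
  Euler characteristics / `𝔽₁`-point counts `#Gr(2,4)(𝔽₁)`, `#Gr(2,5)(𝔽₁)` (Tits: `#(G/P)(𝔽₁) = |W/W_P|`).

### §3 Complete flags (`[n]_q!`)

A *complete flag* of an `n`-dimensional `W` is a maximal chain of subspaces `0 = V₀ < V₁ < ⋯ < V_n = W`,
encoded as a strictly monotone map `Fin (n+1) → Submodule k W` (the dimensions `dim V_i = i`, `V_n = ⊤` are then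
forced). The `q`-integer `[i]_q = 1 + q + ⋯ + q^{i−1}` is written `qBinomial q i 1 = [i choose 1]_q` (no new
definition for `[n]_q!`).

For `k` finite with `q = Nat.card k` and `dim W = n`:

* `card_completeFlag_eq_prod`: `#{complete flags of W} = ∏_{i=1}^{n} [i]_q = [n]_q!`  — the count
  `#(GL_n/B)(𝔽_q)` of [Lorscheid2018, §1.1.2]: "`#GL(n,𝔽_q) = ∏_{i=1}^n (q^n − q^{i−1}) = (q−1)^n q^{(n²−n)/2} [n]_q!`",
  "`[n]_q! = ∏_{i=1}^n [i]_q`" (the Borel subgroup of upper triangular matrices having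
  `(q−1)^n q^{(n²−n)/2}` elements); coordinate form `card_completeFlag_fin_eq_prod` for `W = kⁿ`.
* `prod_qBinomial_one_one_eq_factorial`: at `q = 1`, `∏_{i=1}^{n} [i]_1 = n!` — "`lim_{q→1} [n]_q! = n!`",
  "`# S_n = n!`", "`lim_{q→1} #G/#T = #S_n`" [Lorscheid2018, §1.1.2], i.e. Tits' count of the "flag variety
  over the field of characteristic one": `(G/B)(K₁) = W = S_n` for `G = GL_n` [Tits 1957, §13, as quoted in
  the epigraph of Lorscheid–Thas, arXiv:2305.13809]; `prod_qBinomial_one_one_eq_card_perm` states it as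
  `= #Equiv.Perm (Fin n)`.
* Kernel-evaluated anchors (`example`s): `[3]_2! = 21`, `[4]_2! = 315` — the numbers of complete flags in
  `𝔽₂³`, `𝔽₂⁴`, i.e. `#(GL₃/B)(𝔽₂)`, `#(GL₄/B)(𝔽₂)` — and `[3]_1! = 6 = #S₃`, `[4]_1! = 24 = #S₄`.

## Proof

`card_ge_codim_eq_qBinomial` by induction on the codimension `m` of `C`: for `m = 0` only `Y = ⊤`
(`card_ge_codim_zero`, `card_ge_codim_eq_zero`); for `m + 1` pick `e ∉ C`, so `codim (C + ke) = m`
(`finrank_sup_span_singleton`), and the tree's recursion `card_ge_codim_eq_add` is literally the second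
`q`-Pascal rule `[m+1, j+1]_q = [m, j+1]_q + q^{m−j} [m, j]_q` (`qBinomial_succ_succ'` of
`QPfaffSaalschutz.lean`, = Cohn's (2)); above the top (`j > m`) both sides vanish
(`qBinomial_eq_zero_of_lt`).  The dimension form follows from the codimension form by the symmetry
`qBinomial_symm`, itself proved from the two Pascal rules by induction.  `qBinomial_one` is Pascal's
rule; the closed form is the telescoping of `qBinomial_key` (`(1 − q^{m+1})[k+m+1, k]_q = (1 − q^{k+1})[k+m+1, k+1]_q`).

§3 (flags): induction on `n = dim W`, all `W` at once.  `n = 0`: `W = 0` has the single flag `(0)`.  `n + 1`: send a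
flag `V₀ < ⋯ < V_n < V_{n+1} = W` to its hyperplane `H = V_n` (`finrank_castSucc_last_of_strictMono`); the
fibre over `H` is in bijection with the complete flags of `H` itself (`card_completeFlag_fibre`: restrict by
`comap H.subtype`, rebuild by `map H.subtype` and `Fin.snoc _ ⊤`), so by induction every fibre has `[n]_q!`
elements, and there are `#{H : dim H = n} = [n+1 choose n]_q = [n+1 choose 1]_q = [n+1]_q` hyperplanes
(`card_finrank_eq_qBinomial`, `qBinomial_symm` of §§1–2).

## What is NOT here

The projective-geometry axiomatics of [Cohn2004, §3] are not formalised, nor is any `𝔽₁`-geometry (there is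
no `𝔽₁` object in Mathlib — the `q = 1` statements are identities of the polynomial counts). Partial flag
varieties `G/P` (multinomial `q`-coefficients), other types (`B₂`, `G₂`, …: `#(G/B)(𝔽_q) =
Σ_{w∈W} q^{ℓ(w)}`), and the Bruhat decomposition itself are not formalised.

## References

* [Cohn2004] H. Cohn, *Projective geometry over `𝔽₁` and the Gaussian binomial coefficients*,
  Amer. Math. Monthly 111 (2004) 487–495 = arXiv:math/0407093 (read in the arXiv text, lit key
  `paper:arxiv-math_0407093`: §2 recurrence (2), closed form (3), Theorem 1 with its proof; the
  sentence "Setting `q=1` yields the ordinary binomial coefficients and recurrence"; Puzzle 1 and §§3–4).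
* [Andrews1976Partitions] G. E. Andrews, *The Theory of Partitions* (1976), §3.3 (Gaussian polynomials;
  (3.3.3)–(3.3.4) the two `q`-Pascal rules) — through `Literature.Combinatorics.Enumerative.qBinomial`.
* [Lorscheid2018] O. Lorscheid, *`𝔽₁` for everyone*, Jahresber. DMV 120 (2018) 83–116 = arXiv:1801.05337,
  §1.1.2 "The limit geometry" (read in the arXiv text, lit key `paper:arxiv-1801.05337`, chunk p0005: the
  displays `#S_n = n!`, `[n]_q = Σ_{i<n} q^i`, `[n]_q! = ∏_{i=1}^n [i]_q`, `lim_{q→1}[n]_q! = n!`,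
  `#GL(n,𝔽_q) = (q−1)^n q^{(n²−n)/2}[n]_q!`, `lim_{q→1} #G/#T = #S_n`).
* J. Tits, *Sur les analogues algébriques des groupes semi-simples complexes*, Colloque d'algèbre supérieure
  (Bruxelles 1956), CBRM 1957, 261–289, §13 — not held; §13 read as quoted verbatim in the epigraph of
  O. Lorscheid, K. Thas, *Towards the horizons of Tits's vision*, arXiv:2305.13809 (lit key
  `paper:arxiv-2305.13809`, chunk p0002).
-/

open Module Submodule Finset

namespace Literature.LinearAlgebra.Subspace

open Literature.Combinatorics.Enumerative

/-! ## §1. Gaussian binomial identities (any commutative ring) -/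

section QBinomial

variable {R : Type*} [CommRing R]

/-- Cohn's recurrence (2), `[m+1 choose k+1]_q = [m choose k+1]_q + q^{m−k} [m choose k]_q` for
`k ≤ m` — the second `q`-Pascal rule `qBinomial_succ_succ'` with the subtraction made explicit.
[cite: Cohn2004, §2 (2)] -/
theorem qBinomial_succ_succ_of_le (q : R) {m k : ℕ} (hk : k ≤ m) :
    qBinomial q (m + 1) (k + 1) = qBinomial q m (k + 1) + q ^ (m - k) * qBinomial q m k := by
  obtain ⟨d, rfl⟩ := Nat.exists_eq_add_of_le hk
  rw [Nat.add_sub_cancel_left]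
  exact qBinomial_succ_succ' q k d

/-- "Setting `q = 1` yields the ordinary binomial coefficients and recurrence (i.e., Pascal's
triangle)": `[L choose k]_1 = (L choose k)`. [cite: Cohn2004, §2 (sentence after (2))] -/
theorem qBinomial_one (L k : ℕ) : qBinomial (1 : R) L k = (L.choose k : R) := by
  induction L generalizing k with
  | zero =>
    cases k with
    | zero => simp
    | succ k => simp
  | succ L ih =>
    cases k with
    | zero => simp
    | succ k =>
      rw [qBinomial_succ_succ, one_pow, one_mul, ih, ih, Nat.choose_succ_succ]
      push_cast
      ring

/-- Symmetry of the Gaussian binomial, `[L choose L−k]_q = [L choose k]_q` (`k ≤ L`) — in print the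
evident symmetry of the closed form (3), `[n choose k]_q = [n]_q! / ([k]_q! [n−k]_q!)`; proved here
without division, from the two `q`-Pascal rules by induction. [cite: Cohn2004, §2 (3)] -/
theorem qBinomial_symm (q : R) {L k : ℕ} (hk : k ≤ L) :
    qBinomial q L (L - k) = qBinomial q L k := by
  induction L generalizing k with
  | zero =>
    obtain rfl : k = 0 := Nat.le_zero.mp hk
    rfl
  | succ L ih =>
    cases k with
    | zero => rw [Nat.sub_zero, qBinomial_self, qBinomial_zero_right]
    | succ k =>
      rcases Nat.lt_or_ge k L with hkL | hkL
      · -- `k < L`: expand the left side by the first Pascal rule, the right side by the second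
        obtain ⟨j, hj⟩ : ∃ j, L - k = j + 1 := ⟨L - k - 1, by omega⟩
        rw [Nat.succ_sub_succ, hj, qBinomial_succ_succ, qBinomial_succ_succ_of_le q (by omega : k ≤ L)]
        have h1 : qBinomial q L j = qBinomial q L (k + 1) := by
          rw [← ih (by omega : k + 1 ≤ L)]; congr 1; omega
        have h2 : qBinomial q L (j + 1) = qBinomial q L k := by
          rw [← ih (by omega : k ≤ L)]; congr 1; omega
        rw [h1, h2, show L - k = j + 1 from hj]
        ring
      · -- `k = L`
        obtain rfl : k = L := le_antisymm (by omega) hkL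
        rw [Nat.sub_self, qBinomial_zero_right, qBinomial_self]

/-- The closed form, division-free: `[N choose k]_q · ∏_{i<k} (1 − q^{i+1}) = ∏_{i<k} (1 − q^{N−i})`
(`k ≤ N`), i.e. `[N,k]_q = (q^N−1)(q^{N−1}−1)⋯(q^{N−k+1}−1) / ((q^k−1)(q^{k−1}−1)⋯(q−1))`.
[cite: Cohn2004, §2 (3) and proof of Thm. 1 (first display)] -/
theorem qBinomial_mul_prod_eq_prod (q : R) {N k : ℕ} (hk : k ≤ N) :
    qBinomial q N k * ∏ i ∈ range k, (1 - q ^ (i + 1)) = ∏ i ∈ range k, (1 - q ^ (N - i)) := by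
  induction k with
  | zero => simp
  | succ k ih =>
    rw [prod_range_succ, prod_range_succ, ← ih (by omega), ← mul_assoc]
    -- `(1 − q^{k+1}) [N, k+1]_q = (1 − q^{N−k}) [N, k]_q` (`qBinomial_key` with `N = k + m + 1`)
    obtain ⟨m, hm⟩ : ∃ m, N = k + m + 1 := ⟨N - k - 1, by omega⟩
    have key := qBinomial_key q k m
    rw [← hm] at key
    rw [show N - k = m + 1 by omega]
    linear_combination (∏ i ∈ range k, (1 - q ^ (i + 1))) * key.symm

/-- `[4 choose 2]_2 = 35 = #Gr(2,4)(𝔽₂)` and `[5 choose 2]_2 = 155 = #Gr(2,5)(𝔽₂)` (kernel evaluation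
of the recursion). [cite: Cohn2004, Thm. 1] -/
example : qBinomial (2 : ℤ) 4 2 = 35 ∧ qBinomial (2 : ℤ) 5 2 = 155 := by
  norm_num [qBinomial]

/-- `[4 choose 2]_1 = 6`, `[5 choose 2]_1 = 10`: the `q = 1` (Euler characteristic / `𝔽₁`-point)
counts of `Gr(2,4)`, `Gr(2,5)`. [cite: Cohn2004, §2] -/
example : qBinomial (1 : ℤ) 4 2 = 6 ∧ qBinomial (1 : ℤ) 5 2 = 10 := by
  norm_num [qBinomial]

end QBinomial

/-! ## §2. Counting subspaces -/

section Count

variable {k W : Type*} [Field k] [Finite k] [AddCommGroup W] [Module k W] [FiniteDimensional k W]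

/-- **The closed count behind `MoebiusCount.card_ge_codim_eq_add`.** For a subspace `C` of
codimension `m = dim W − dim C`, the subspaces `Y ⊇ C` of codimension `j` number `[m choose j]_q`,
`q = #k`. [cite: Cohn2004, Thm. 1 and (2)] -/
theorem card_ge_codim_eq_qBinomial (C : Submodule k W) (j : ℕ) :
    (Nat.card {Y : Submodule k W // C ≤ Y ∧ finrank k Y + j = finrank k W} : ℤ) =
      qBinomial (Nat.card k : ℤ) (finrank k W - finrank k C) j := by
  suffices h : ∀ m : ℕ, ∀ C : Submodule k W, finrank k W - finrank k C = m → ∀ j : ℕ,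
      (Nat.card {Y : Submodule k W // C ≤ Y ∧ finrank k Y + j = finrank k W} : ℤ) =
        qBinomial (Nat.card k : ℤ) m j from
    h _ C rfl j
  intro m
  induction m with
  | zero =>
    intro C hC j
    have hCW : finrank k C ≤ finrank k W := Submodule.finrank_le C
    cases j with
    | zero => rw [card_ge_codim_zero]; simp
    | succ j => rw [card_ge_codim_eq_zero C (by omega)]; simp
  | succ m ih =>
    intro C hC j
    have hne : C ≠ ⊤ := by
      rintro rfl
      rw [finrank_top] at hC
      omega
    obtain ⟨e, -, he⟩ := SetLike.exists_of_lt (lt_top_iff_ne_top.2 hne)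
    have hCe : finrank k W - finrank k ↥(C ⊔ (k ∙ e)) = m := by
      rw [finrank_sup_span_singleton he]
      omega
    cases j with
    | zero => rw [card_ge_codim_zero]; simp
    | succ j =>
      rw [card_ge_codim_eq_add C he (Nat.le_add_left 1 j), Nat.add_sub_cancel]
      push_cast
      rw [ih _ hCe (j + 1), ih _ hCe j]
      by_cases hjm : j ≤ m
      · rw [qBinomial_succ_succ_of_le _ hjm, show finrank k W - finrank k C - (j + 1) = m - j by omega]
      · rw [qBinomial_eq_zero_of_lt _ (by omega : m + 1 < j + 1),
          qBinomial_eq_zero_of_lt _ (by omega : m < j + 1), qBinomial_eq_zero_of_lt _ (by omega : m < j)]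
        ring

/-- The subspaces of codimension `j` number `[dim W choose j]_q`. [cite: Cohn2004, Thm. 1] -/
theorem card_codim_eq_qBinomial (j : ℕ) :
    (Nat.card {Y : Submodule k W // finrank k Y + j = finrank k W} : ℤ) =
      qBinomial (Nat.card k : ℤ) (finrank k W) j := by
  have h := card_ge_codim_eq_qBinomial (⊥ : Submodule k W) j
  rw [finrank_bot, Nat.sub_zero] at h
  rw [← h]
  exact congrArg _ (Nat.card_congr (Equiv.subtypeEquivRight fun Y => by simp))

/-- **Cohn's Theorem 1** ("`[n choose k]_q` is the number of `k`-dimensional subspaces of `𝔽_qⁿ`"),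
for any finite field `k` with `q` elements and any `W` of dimension `n`: the subspaces of dimension
`d` number `[n choose d]_q` (both sides vanish for `d > n`). [cite: Cohn2004, Thm. 1] -/
theorem card_finrank_eq_qBinomial (d : ℕ) :
    (Nat.card {Y : Submodule k W // finrank k Y = d} : ℤ) = qBinomial (Nat.card k : ℤ) (finrank k W) d := by
  rcases le_or_gt d (finrank k W) with hd | hd
  · rw [← qBinomial_symm _ hd, ← card_codim_eq_qBinomial (finrank k W - d)]
    exact congrArg _ (Nat.card_congr (Equiv.subtypeEquivRight fun Y => by
      constructor
      · intro h; omega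
      · intro h; omega))
  · rw [qBinomial_eq_zero_of_lt _ hd, Nat.cast_eq_zero, Nat.card_eq_zero]
    left
    refine ⟨fun Y => ?_⟩
    have h1 : finrank k Y.1 ≤ finrank k W := Submodule.finrank_le Y.1
    have h2 := Y.2
    omega

/-- Coordinate form of Cohn's Theorem 1: the `d`-dimensional subspaces of `kⁿ` number `[n choose d]_q`,
`q = #k`. [cite: Cohn2004, Thm. 1] -/
theorem card_subspaces_fin_eq_qBinomial (n d : ℕ) :
    (Nat.card {Y : Submodule k (Fin n → k) // finrank k Y = d} : ℤ) = qBinomial (Nat.card k : ℤ) n d := by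
  rw [card_finrank_eq_qBinomial, finrank_fin_fun]

/-- The `q = 1` count: `[n choose d]_1` is the number of `d`-element subsets of an `n`-element set —
Cohn's "`d`-dimensional subspaces of `𝔽₁ⁿ`" (`𝔽₁ⁿ` = the `n`-element set, subspaces = subsets).
[cite: Cohn2004, §§3–4 (solution of Puzzle 1) with §2] -/
theorem qBinomial_one_eq_card_powersetCard (n d : ℕ) :
    qBinomial (1 : ℤ) n d = (((univ : Finset (Fin n)).powersetCard d).card : ℤ) := by
  rw [qBinomial_one, card_powersetCard, card_univ, Fintype.card_fin]

/-- The census anchor: `𝔽₂⁴` has exactly `35 = [4 choose 2]_2` two-dimensional subspaces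
(`#Gr(2,4)(𝔽₂) = 35`). [cite: Cohn2004, Thm. 1] -/
example : (Nat.card {Y : Submodule (ZMod 2) (Fin 4 → ZMod 2) // finrank (ZMod 2) Y = 2} : ℤ) = 35 := by
  haveI : Fact (Nat.Prime 2) := ⟨Nat.prime_two⟩
  have h35 : qBinomial ((Nat.card (ZMod 2) : ℕ) : ℤ) 4 2 = 35 := by
    rw [Nat.card_zmod]; norm_num [qBinomial]
  exact (card_subspaces_fin_eq_qBinomial (k := ZMod 2) 4 2).trans h35

end Count

/-! ## §3. Complete flags: `#(GL_n/B)(𝔽_q) = [n]_q!`, and `n! = #S_n` at `q = 1` -/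

universe u v

section Chains

variable {k : Type u} [Field k] {W : Type v} [AddCommGroup W] [Module k W] [FiniteDimensional k W]

/-- Along a strict chain of subspaces `c₀ < c₁ < ⋯` the dimension grows by at least one at each step:
`i ≤ dim cᵢ` (helper). [folklore] -/
private theorem le_finrank_of_strictMono {m : ℕ} {c : Fin (m + 1) → Submodule k W} (hc : StrictMono c)
    (i : Fin (m + 1)) : (i : ℕ) ≤ finrank k (c i) := by
  obtain ⟨i, hi⟩ := i
  induction i with
  | zero => exact Nat.zero_le _
  | succ i ih =>
    have h1 := ih (by omega)
    have h2 : c ⟨i, by omega⟩ < c ⟨i + 1, hi⟩ := hc (Fin.mk_lt_mk.2 (by omega))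
    have h3 := Submodule.finrank_lt_finrank_of_lt h2
    dsimp only at h1 ⊢
    omega

/-- The top of a strict chain of `dim W + 1` subspaces is `W` itself (helper). [folklore] -/
private theorem eq_top_of_strictMono {n : ℕ} (hW : finrank k W = n) {c : Fin (n + 1) → Submodule k W}
    (hc : StrictMono c) : c (Fin.last n) = ⊤ := by
  apply Submodule.eq_top_of_finrank_eq
  have h1 := le_finrank_of_strictMono hc (Fin.last n)
  have h2 : finrank k (c (Fin.last n)) ≤ finrank k W := Submodule.finrank_le _
  rw [Fin.val_last] at h1
  omega

/-- In a strict chain of `dim W + 1 = n + 2` subspaces the second-to-top member is a hyperplane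
(`dim = n`) (helper). [folklore] -/
private theorem finrank_castSucc_last_of_strictMono {n : ℕ} (hW : finrank k W = n + 1)
    {c : Fin (n + 2) → Submodule k W} (hc : StrictMono c) :
    finrank k (c (Fin.last n).castSucc) = n := by
  have h1 := le_finrank_of_strictMono hc (Fin.last n).castSucc
  have h2 : c (Fin.last n).castSucc < c (Fin.last (n + 1)) := hc (Fin.castSucc_lt_last _)
  have h3 := Submodule.finrank_lt_finrank_of_lt h2
  have h4 : finrank k (c (Fin.last (n + 1))) ≤ finrank k W := Submodule.finrank_le _
  rw [Fin.val_castSucc, Fin.val_last] at h1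
  omega

omit [FiniteDimensional k W] in
/-- Restriction to a subspace `H` is strictly monotone on the subspaces below `H`. [folklore] -/
private theorem comap_subtype_lt_of_lt_of_le {H A B : Submodule k W} (hAB : A < B) (hB : B ≤ H) :
    A.comap H.subtype < B.comap H.subtype := by
  refine lt_of_le_of_ne (Submodule.comap_mono hAB.le) fun h => hAB.ne ?_
  have h' := congrArg (Submodule.map H.subtype) h
  simp only [Submodule.map_comap_subtype] at h'
  rwa [inf_eq_right.2 (hAB.le.trans hB), inf_eq_right.2 hB] at h'

/-- **The fibre of `flag ↦ its hyperplane`.** For `dim W = n + 1` and a hyperplane `H` (`dim H = n`), the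
complete flags of `W` whose second-to-top member is `H` correspond bijectively to the complete flags of `H`
(restrict along `H ↪ W`; conversely push forward and append `W`) — the induction step of
`card_completeFlag_eq_prod` (helper). [folklore] -/
private theorem card_completeFlag_fibre {n : ℕ} (hW : finrank k W = n + 1) (H : Submodule k W)
    (hH : finrank k H = n) :
    Nat.card {c : Fin (n + 2) → Submodule k W // StrictMono c ∧ c (Fin.last n).castSucc = H} =
      Nat.card {c : Fin (n + 1) → Submodule k H // StrictMono c} := by
  have hHtop : H < ⊤ := by
    refine lt_top_iff_ne_top.2 fun h => ?_
    rw [h, finrank_top] at hH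
    omega
  refine Nat.card_congr
    { toFun := fun c => ⟨fun i => (c.1 i.castSucc).comap H.subtype, fun i j hij => ?_⟩
      invFun := fun c => ⟨Fin.snoc (fun i => (c.1 i).map H.subtype) ⊤, ?_, ?_⟩
      left_inv := fun c => ?_
      right_inv := fun c => ?_ }
  · -- strict monotonicity of the restriction
    have hle : c.1 j.castSucc ≤ H :=
      le_of_le_of_eq (c.2.1.monotone (Fin.castSucc_le_castSucc_iff.2 (Fin.le_last j))) c.2.2
    exact comap_subtype_lt_of_lt_of_le (c.2.1 (Fin.castSucc_lt_castSucc_iff.2 hij)) hle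
  · -- strict monotonicity of the extension
    rw [Fin.strictMono_iff_lt_succ]
    intro i
    induction i using Fin.lastCases with
    | last =>
      rw [Fin.snoc_castSucc, Fin.succ_last, Fin.snoc_last]
      exact lt_of_le_of_lt (Submodule.map_subtype_le H _) hHtop
    | cast j =>
      rw [Fin.snoc_castSucc, Fin.succ_castSucc, Fin.snoc_castSucc]
      exact Submodule.map_strictMono_of_injective H.injective_subtype (c.2 Fin.castSucc_lt_succ)
  · -- the hyperplane of the extension is `H`
    rw [Fin.snoc_castSucc, eq_top_of_strictMono hH c.2, Submodule.map_subtype_top]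
  · -- restriction then extension
    apply Subtype.ext
    funext i
    dsimp only
    induction i using Fin.lastCases with
    | last =>
      rw [Fin.snoc_last]
      exact (eq_top_of_strictMono hW c.2.1).symm
    | cast j =>
      rw [Fin.snoc_castSucc, Submodule.map_comap_subtype, inf_eq_right]
      exact le_of_le_of_eq (c.2.1.monotone (Fin.castSucc_le_castSucc_iff.2 (Fin.le_last j))) c.2.2
  · -- extension then restriction
    apply Subtype.ext
    funext i
    dsimp only
    rw [Fin.snoc_castSucc, Submodule.comap_map_eq_of_injective H.injective_subtype]

end Chains

section FlagCount

variable {k : Type u} [Field k] [Finite k]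

/-- **The number of complete flags is the `q`-factorial.** For a finite field `k` with `q` elements and
every `k`-space `W` of dimension `n`, the strict chains `V₀ < V₁ < ⋯ < V_n` of subspaces (complete flags;
necessarily `dim Vᵢ = i`) number `∏_{i=1}^{n} [i]_q = [n]_q!` (`[i]_q = [i choose 1]_q`), i.e.
`#(GL_n/B)(𝔽_q) = [n]_q!`. [cite: Lorscheid2018, §1.1.2] -/
theorem card_completeFlag_eq_prod (n : ℕ) :
    ∀ (W : Type v) [AddCommGroup W] [Module k W] [FiniteDimensional k W], finrank k W = n →
      (Nat.card {c : Fin (n + 1) → Submodule k W // StrictMono c} : ℤ) =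
        ∏ i ∈ range n, qBinomial (Nat.card k : ℤ) (i + 1) 1 := by
  induction n with
  | zero =>
    intro W _ _ _ hW
    haveI : Subsingleton W := Module.finrank_zero_iff.1 hW
    haveI : Subsingleton (Submodule k W) := (Submodule.subsingleton_iff k).2 inferInstance
    haveI : Unique {c : Fin (0 + 1) → Submodule k W // StrictMono c} :=
      { default := ⟨fun _ => ⊥, fun a b h => absurd (Fin.lt_def.1 h) (by have := a.2; have := b.2; omega)⟩
        uniq := fun c => Subsingleton.elim _ _ }
    rw [Nat.card_unique, prod_range_zero, Nat.cast_one]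
  | succ n ih =>
    intro W _ _ _ hW
    classical
    haveI : Finite W := Module.finite_of_finite k
    -- the hyperplane map and its fibres
    let T := {H : Submodule k W // finrank k H = n}
    haveI : Fintype T := Fintype.ofFinite _
    let π : {c : Fin (n + 2) → Submodule k W // StrictMono c} → T :=
      fun c => ⟨c.1 (Fin.last n).castSucc, finrank_castSucc_last_of_strictMono hW c.2⟩
    have hfib : ∀ H : T, (Nat.card {c // π c = H} : ℤ) = ∏ i ∈ range n, qBinomial (Nat.card k : ℤ) (i + 1) 1 := by
      intro H
      rw [← ih H.1 H.2, ← card_completeFlag_fibre hW H.1 H.2]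
      exact congrArg _ (Nat.card_congr ((Equiv.subtypeSubtypeEquivSubtypeExists _ _).trans
        (Equiv.subtypeEquivRight fun c =>
          ⟨fun ⟨h, e⟩ => ⟨h, Subtype.ext_iff.1 e⟩, fun ⟨h, e⟩ => ⟨h, Subtype.ext e⟩⟩)))
    rw [← Nat.card_congr (Equiv.sigmaFiberEquiv π), Nat.card_sigma, Nat.cast_sum,
      Finset.sum_congr rfl fun H _ => hfib H, sum_const, card_univ, nsmul_eq_mul, prod_range_succ,
      ← Nat.card_eq_fintype_card]
    -- the number of hyperplanes: `[n+1 choose n]_q = [n+1 choose 1]_q`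
    have hT : (Nat.card T : ℤ) = qBinomial (Nat.card k : ℤ) (n + 1) 1 := by
      rw [card_finrank_eq_qBinomial, hW, ← qBinomial_symm _ (Nat.le_add_left 1 n), Nat.add_sub_cancel]
    rw [hT, mul_comm]

/-- Coordinate form: the complete flags of `kⁿ` number `∏_{i=1}^{n} [i]_q = [n]_q!`, `q = #k`.
[cite: Lorscheid2018, §1.1.2] -/
theorem card_completeFlag_fin_eq_prod (n : ℕ) :
    (Nat.card {c : Fin (n + 1) → Submodule k (Fin n → k) // StrictMono c} : ℤ) =
      ∏ i ∈ range n, qBinomial (Nat.card k : ℤ) (i + 1) 1 :=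
  card_completeFlag_eq_prod n (Fin n → k) (finrank_fin_fun k)

end FlagCount

section CharacteristicOne

/-- "`lim_{q→1} [n]_q! = n!`": at `q = 1` the flag count `∏_{i=1}^{n} [i]_q` is `n!` — Tits' `(GL_n/B)(K₁) =
S_n` ("`# S_n = n!`", "`lim_{q→1} #G/#T = # S_n`"). [cite: Lorscheid2018, §1.1.2] -/
theorem prod_qBinomial_one_one_eq_factorial (n : ℕ) :
    ∏ i ∈ range n, qBinomial (1 : ℤ) (i + 1) 1 = (n.factorial : ℤ) := by
  simp_rw [qBinomial_one, Nat.choose_one_right]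
  rw [← Finset.prod_range_add_one_eq_factorial, Nat.cast_prod]

/-- The same count as the order of the symmetric group: `∏_{i=1}^{n} [i]_1 = #S_n` ("`GL(n, 𝔽₁) = S_n`").
[cite: Lorscheid2018, §1.1.2] -/
theorem prod_qBinomial_one_one_eq_card_perm (n : ℕ) :
    ∏ i ∈ range n, qBinomial (1 : ℤ) (i + 1) 1 = (Fintype.card (Equiv.Perm (Fin n)) : ℤ) := by
  rw [prod_qBinomial_one_one_eq_factorial, Fintype.card_perm, Fintype.card_fin]

/-- Anchors: `[3]_2! = 1·3·7 = 21` and `[4]_2! = 21·15 = 315` (the numbers of complete flags of `𝔽₂³`,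
`𝔽₂⁴`), and `[3]_1! = 6 = #S₃`, `[4]_1! = 24 = #S₄`. [cite: Lorscheid2018, §1.1.2] -/
example : (∏ i ∈ range 3, qBinomial (2 : ℤ) (i + 1) 1 = 21 ∧ ∏ i ∈ range 4, qBinomial (2 : ℤ) (i + 1) 1 = 315)
    ∧ (∏ i ∈ range 3, qBinomial (1 : ℤ) (i + 1) 1 = 6 ∧ ∏ i ∈ range 4, qBinomial (1 : ℤ) (i + 1) 1 = 24) := by
  simp only [prod_range_succ, prod_range_zero]
  norm_num [qBinomial]

/-- The census anchor as a cardinality statement: `𝔽₂³` has exactly `21 = [3]_2!` complete flags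
(`#(GL₃/B)(𝔽₂) = 21`). [cite: Lorscheid2018, §1.1.2] -/
example : (Nat.card {c : Fin 4 → Submodule (ZMod 2) (Fin 3 → ZMod 2) // StrictMono c} : ℤ) = 21 := by
  haveI : Fact (Nat.Prime 2) := ⟨Nat.prime_two⟩
  have h : ∏ i ∈ range 3, qBinomial ((Nat.card (ZMod 2) : ℕ) : ℤ) (i + 1) 1 = 21 := by
    rw [Nat.card_zmod]; simp only [prod_range_succ, prod_range_zero]; norm_num [qBinomial]
  exact (card_completeFlag_fin_eq_prod (k := ZMod 2) 3).trans h

end CharacteristicOne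

end Literature.LinearAlgebra.Subspace
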